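import Mathlib

/-!
# A residually trivial prime off the polar divisor obstructs polar Artin–Schreier generators

Solo-blind programme on `ResolutionOfSingularities`, local theory at a `(ii₁)` point (paper §18.8,
Remark 18.15(ii)).  Let `σ` be a ring endomorphism of `R`, `x ∈ R` with `σ x = x * u`
(the fixed divisor `E = {x = 0}`), and suppose some prime `P ∌ x` is *residually fixed*:
`σ r - r ∈ P` for all `r` (a fixed point, or a fixed curve such as `γ̄`, off `E`).
Then no `θ = g / xⁿ` can satisfy `σ θ = θ + 1`, i.e. there are no `g`, `n` with
`σ g = (g + xⁿ) * uⁿ`.  Contrapositive: an Artin–Schreier generator with poles only along `E`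
forces the action to be free off `E`.  This is the elementary half of
"Conjecture F ⟺ no `E`-polar Artin–Schreier generator".
-/

namespace Summit.ResolutionOfSingularities.ResolutionOfSingularities.Theorems.SoloBlind

/-- If `σ` fixes the prime `P` residually (`σ r ≡ r mod P` for all `r`), `x ∉ P` and `σ x = x * u`,
then `u ≡ 1 mod P`. -/
theorem multiplier_sub_one_mem {R : Type*} [CommRing R] (σ : R →+* R) {P : Ideal R}
    (hP : P.IsPrime) (hfix : ∀ r, σ r - r ∈ P) {x u : R} (hx : x ∉ P) (hσx : σ x = x * u) :
    u - 1 ∈ P := by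
  have h := hfix x
  rw [hσx] at h
  have h' : x * (u - 1) ∈ P := by
    have e : x * (u - 1) = x * u - x := by ring
    rw [e]; exact h
  exact (hP.mem_or_mem h').resolve_left hx

/-- **No polar Artin–Schreier generator.**  With `σ`, `P`, `x`, `u` as above there are no `g : R`
and `n : ℕ` with `σ g = (g + x ^ n) * u ^ n` (which is the equation `σ (g/xⁿ) = g/xⁿ + 1`
cleared of denominators, using `σ (xⁿ) = xⁿ uⁿ`). -/
theorem no_polar_artinSchreier_generator {R : Type*} [CommRing R] (σ : R →+* R) {P : Ideal R}
    (hP : P.IsPrime) (hfix : ∀ r, σ r - r ∈ P) {x u : R} (hx : x ∉ P) (hσx : σ x = x * u)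
    (g : R) (n : ℕ) (hg : σ g = (g + x ^ n) * u ^ n) : False := by
  have hu : u - 1 ∈ P := multiplier_sub_one_mem σ hP hfix hx hσx
  have hun : u ^ n - 1 ∈ P := by
    obtain ⟨c, hc⟩ := sub_dvd_pow_sub_pow u 1 n
    rw [one_pow] at hc
    rw [hc]; exact P.mul_mem_right c hu
  have h2 : (g + x ^ n) * u ^ n - g ∈ P := by rw [← hg]; exact hfix g
  have h3 : x ^ n * u ^ n ∈ P := by
    have h4 : g * (u ^ n - 1) ∈ P := P.mul_mem_left g hun
    have h5 := P.sub_mem h2 h4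
    have e : (g + x ^ n) * u ^ n - g - g * (u ^ n - 1) = x ^ n * u ^ n := by ring
    rw [e] at h5; exact h5
  rcases hP.mem_or_mem h3 with h6 | h6
  · exact hx (hP.mem_of_pow_mem n h6)
  · have hu' : u ∈ P := hP.mem_of_pow_mem n h6
    have h1 : (1 : R) ∈ P := by
      have h7 := P.sub_mem hu' hu
      have e : u - (u - 1) = (1 : R) := by ring
      rw [e] at h7; exact h7
    exact hP.ne_top ((Ideal.eq_top_iff_one P).mpr h1)

/-- The same with the generator equation in its `θ`-free multiplicative form for `σ (x ^ n)`:
`σ (x ^ n) = x ^ n * u ^ n` is automatic from `σ x = x * u`. -/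
theorem map_pow_eq_mul_pow {R : Type*} [CommRing R] (σ : R →+* R) {x u : R} (hσx : σ x = x * u)
    (n : ℕ) : σ (x ^ n) = x ^ n * u ^ n := by
  rw [map_pow, hσx, mul_pow]

end Summit.ResolutionOfSingularities.ResolutionOfSingularities.Theorems.SoloBlind
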